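import Mathlib
import HarnessLib
import HarnessLib.Audit
import Summits.HodgeConjecture.HodgeConjecture.Statement
import Literature.AlgebraicGeometry.Motives.SmoothHypersurfaceScheme
import Literature.AlgebraicGeometry.HodgeTheory.HypersurfaceComplexPoints
import Literature.AlgebraicGeometry.HodgeTheory.HodgeConjecture
import HarnessLib.Audit.Status.Attr

/-!
Route: DworkPrymHodge

CLOSED (retired) 2026-08-15T13:48:13Z by operator:999:1257524 — reason: not-a-thesis: assembly does not conclude the sub-problem Statement — note: D-0027 §2.1 audit (human 2026-08-15: routes that do not decide the summit are removed): the assembly concludes `DworkSexticHodge`, not the sub-problem statement; a NEW conforming route may be opened from the same idea (generated `closes : … → _root_.HodgeConjecture`).. The file is kept as the record of this route; refuted decls are indexed as negative knowledge (`ledger negatives`).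

Thesis X (route DworkPrymHodge; realises idea card dwork-prym-hodge-ladder). Let X_ψ ⊂ P⁵ be the
Dwork sextic fourfold Σ_{i<6} x_i⁶ = 6ψ·∏ x_i (smooth iff ψ⁶ ≠ 1), A = {a ∈ μ₆⁶ : ∏ a_i = 1}/μ₆ ≅
(ℤ/6)⁴ its group of diagonal symmetries, and V_b(ψ) ⊂ H⁴(X_ψ(ℂ); ℂ) the χ_b-eigenspace of A (χ_b(a)
= ∏ a_i^{b_i}). By Katz2009 Lemma 3.1 (rank and Hodge ranks of an eigensheaf = number of
totally-nonzero translates b + r·(1,…,1) and their degrees) the pieces with b a permutation of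
(1,2,3,3,4,5) [rank 1; 360 characters], of (1,2,2,3,5,5) or (1,1,2,4,5,5) [rank 2; 2×180], or of
(1,1,3,3,5,5) [rank 3; 30] are, at EVERY smooth ψ, purely of Hodge type (2,2): a 1170-dimensional
space of flat Hodge classes (brute-force check: H⁴_prim has Hodge numbers (1,426,1751,426,1); flat
part 360·1 + 360·2 + 30·3 = 1170) with finite monodromy — for rank 1 it is −1 exactly at the six
conifold points ψ⁶ = 1 (Katz2009 Thm 5.3: the piece is [6]^*H(1;χ₃)), so the class is the character
transform Σ_g χ_b(g)⁻¹ g·δ of the 1296 conifold vanishing spheres; all these classes are algebraic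
at ψ = 0 (Fermat sextic: Shioda1979HodgeFermat, Aoki1987, arXiv:2401.00470) and motivated, hence
absolute Hodge, on every X_ψ (Andre1996).
It suffices to show X := for every ψ with ψ⁶ ≠ 1 and every flat b, every RATIONAL class in V_b(ψ) ⊕
V_{−b}(ψ) is algebraic (lies in algebraicClasses X_ψ 2) — filed as the two cruxes
SingletonLinesAlgebraic (rank-1 pieces: conifold-conjugate pairs of surfaces) and
MultipletonPiecesAlgebraic (rank-2/3 pieces: reflection-orbit version; free sub-engine on
conifold-invariant sublattices). Then, with the theorem-grade support GenericHodgeClassesFlat (off a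
countable set of ψ every rational (2,2)-class is an algebraic A-invariant part plus rational flat
components: Katz2009 Thm 5.3 + irreducibility of hypergeometric sheaves + countability of Hodge
loci) and DworkOtherCodimensions (Hodge model; Lefschetz in codimension ≠ 2), the Hodge conjecture
holds for the very general Dwork sextic fourfold (target DworkSexticHodge) — sextic = the first
Calabi–Yau degree for fourfold hypersurfaces (cubic: Zucker; quartic, quintic: ConteMurre1978;
Fermat sextic: Shioda), where 1170 of the 1171 generic Hodge classes are primitive and invisible to
divisors (H² = ℚh).
X in Lean (elaborates; exact text = decls SingletonLinesAlgebraic, MultipletonPiecesAlgebraic of the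
route file). With F_ψ := (∑ i, MvPolynomial.X i ^ 6) - MvPolynomial.C (6 * ψ) * ∏ i, MvPolynomial.X
i : MvPolynomial (Fin 6) ℂ, X_ψ :=
Literature.AlgebraicGeometry.Motives.SmoothHypersurface.hypersurface F_ψ, pt :=
Literature.AlgebraicGeometry.HodgeTheory.hypersurfacePoint (hypersurfaceι F_ψ) : X_ψ(ℂ) → ℙ(ℂ⁶), and
IsEig b c := ∀ a : Fin 6 → ℂ, (∀ i, a i ^ 6 = 1) → ∏ i, a i = 1 → ∀ g : C(X_ψ(ℂ), X_ψ(ℂ)), (∀ x, ∃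
t, (pt (g x)).rep = t • (a * (pt x).rep)) → singularCohomology.map ℂ ℂ g (2*2) c = (∏ i, a i ^ b i)
• c, the thesis reads: ∀ ψ, ψ ^ 6 ≠ 1 → ∀ σ : Equiv.Perm (Fin 6), ∀ u v : complexBetti X_ψ (2*2),
IsEig (b ∘ σ) u → IsEig (6 − b ∘ σ) v → IsRationalClass (u + v) → u + v ∈ algebraicClasses X_ψ 2,
for b = (1,2,3,3,4,5) [crux r2] and b ∈ {(1,2,2,3,5,5), (1,1,2,4,5,5), (1,1,3,3,5,5)} [crux r3].
Target (Lean): ∃ S : Set ℂ, S.Countable ∧ ∀ ψ ∉ S,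
Literature.AlgebraicGeometry.HodgeTheory.HodgeConjectureFor 4 (hypersurface F_ψ). A named sub-family
instance of HodgeConjecture (kind target); Assembly := SingletonLinesAlgebraic →
MultipletonPiecesAlgebraic → GenericHodgeClassesFlat → DworkOtherCodimensions → DworkSexticHodge
(bookkeeping). Not a route to the summit.

Rationale: WHY THIS LINE. The Dwork sextic pencil is the most structured open instance of HC I know: a
one-parameter family over ℚ whose middle cohomology splits under an abelian symmetry group into
HYPERGEOMETRIC local systems (Katz2009 Thm 5.3; 'parameters interlace ⟺ finite monodromy ⟺ one Hodge
degree', BeukersHeckman1989), so the generic Hodge classes are known exactly (1 + 1170), are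
algebraic at one fibre (Fermat: Shioda1979HodgeFermat, Aoki1987, arXiv:2401.00470), motivated
everywhere (Andre1996), and — the card's identification — equal to CHARACTER TRANSFORMS OF CONIFOLD
VANISHING SPHERES (monodromy −1 at ψ⁶ = 1). Imports: hypergeometric/ℓ-adic monodromy (Katz2009,
Kloosterman2017) for the bookkeeping; Picard–Lefschetz/cycles-from-nodes (Schoen Math.Ann.270 (1985)
17–27, Thomas2005Nodes) for the conifold-conjugate-pair mechanism; variational Hodge /
semiregularity (Bloch1972Semiregularity, BuchweitzFlenner2003, Pridham2024) as the second engine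
(transport from the algebraic Fermat anchor); exact computer algebra (character-weighted
intersection certificates, Fermat jets à la Movasati–Villaflor arXiv:1705.00084, 2112.14818) for
refutation-grade evidence. The target 'HC for the very general Dwork sextic fourfold' is the first
CY degree for fourfold hypersurfaces and is reduced here to two typed cruxes by a theorem-grade
lemma.
RANKED CRUXES (typed, elaborate; see thesis for the encoding of V_b via continuous maps realising
the diagonal action).
 r2 SingletonLinesAlgebraic — the 360 rank-1 flat lines (180 rational planes V_b ⊕ V_{−b}, b ~
(1,2,3,3,4,5)) are algebraic on every smooth X_ψ. Mechanism: conifold-conjugate pairs Z± exchanged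
by the local monodromy, [Z+]−[Z−] ∈ ℚ^×·(δ_b-part); equivalently (A-stability of algebraic classes)
ONE surface Z ⊂ X_ψ with Σ_g χ_b(g)⟨Z, g·Z⟩ ≠ 0 suffices per (b, ψ); spread: very general ψ ⇒ all ψ.
 r3 MultipletonPiecesAlgebraic — the rank-2/3 flat pieces (b ~ (1,2,2,3,5,5) | (1,1,2,4,5,5) |
(1,1,3,3,5,5); 810 dims). Monodromy = finite group generated by six conifold reflections; the
sublattice fixed by all of them is algebraic FOR FREE (Deligne1971 global invariant cycles on 𝒳 →
A¹∖μ₆ + BlochSrinivas1983 degree-4 HC for the rational total space 𝒳 ≃_bir P⁵) — a finite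
computation decides its rank; the rest needs the reflection-orbit analogue of r2.
SUPPORT (theorem-grade, filed so the Assembly is bookkeeping). GenericHodgeClassesFlat (off a
countable set: rational (2,2)-classes = algebraic invariant part + rational flat components;
Katz2009 L.3.1/Thm 5.3, irreducibility of hypergeometrics with disjoint parameters, Baire/CDK
countability of Hodge loci, ℚ(ζ₆)⁺ = ℚ for rationality of paired projectors); DworkOtherCodimensions
(HodgeModel by GAGA; codim 0,1,3,4 by Lefschetz (1,1), weak/hard Lefschetz, point class);
DworkSymmetryExists (construction statement for the posited action: the diagonal maps exist on
X_ψ(ℂ); uniqueness from injectivity of hypersurfacePoint is in-tree).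
ASSEMBLY. SingletonLinesAlgebraic → MultipletonPiecesAlgebraic → GenericHodgeClassesFlat →
DworkOtherCodimensions → DworkSexticHodge: take S ∪ {ψ⁶ = 1}; decompose a rational (2,2)-class by
GenericHodgeClassesFlat; each flat component is rational and in V_b ⊕ V_{−b}, hence algebraic by
r2/r3 (pattern index j = 0 vs j = 1,2,3: Matrix.cons_val_succ); sum in the submodule. Provable now.
KILL CRITERIA. (a) Enumeration/Hodge-type error ⇒ r2/r3 would assert algebraicity of non-(2,2)
rational classes: refutable; guarded by brute force (2605 = 1+426+1751+426+1; flat 1170) = Katz2009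
L.3.1. (b) A proof that some flat rational class is not algebraic refutes HC itself (classes are
motivated: only possible if conjecture B fails) — not expected; realistic failure = unreachability:
close EXHAUSTED only with a census (symmetric ansätze of degree ≤ D certified empty by E2, Fermat
jets E3 obstructed, E0 rank computed). (c) Literature shows the surfaces are known ⇒
supersede/retarget to m = 8 (20160 rank-1 classes of type (3,3)).
NOT DECOMPOSED YET (depth is earned): ConifoldPairs / LogLift on Bl_nodes(X_1) (card W1/W2) as
children of r2; the E0 module computation and reflection-orbit statement as children of r3;
Fermat-jet statement E3; Literature definitions (dworkForm, isotypic projectors, vanishing spheres)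
to shorten signatures; nothing for m = 8 or other GKZ pencils (the 'ladder') until r2 moves.
RELATION TO SIBLING ROUTES (opened today). AnchorTransport (abstract variational Hodge V +
AnchorExistence): after base change to the double cover of the ψ-line branched at ψ⁶ = 1 (rank 1; a
finite cover for rank 2/3) the flat classes become monodromy-invariant, hence global classes by the
fixed-part theorem, with algebraic anchor ψ = 0 — so AnchorTransport.VariationalHodge ⇒ r2 ∧ r3:
this route is the first explicit, finite-dimensional TEST-BED of that crux (and a proof here by
conifold pairs or E0 needs no V). NodalSupport (Thomas' nodal hypersurface SECTIONS of a fixed X)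
and PadicSemiregularLift (p-adic object lifting) are different mechanisms; the Fermat/supersingular
anchors they use coincide with ours at ψ = 0 only.

Novelty: NEAREST PRIOR ART: Katz2009 (eigensheaves of the Dwork family = [d]^* hypergeometric sheaves, Lemma
3.1 / Thm 5.3: source of the enumeration and of monodromy −1 for rank-1 pieces); Kloosterman2017 =
arXiv:1706.01626 (isotypic Tate-twist pieces of monomial-deformation pencils; cycle hunting via
symmetric quotients done for K3 pencils, §3); Shioda1979HodgeFermat, Aoki1987, Ran1980,
arXiv:2401.00470 (complete cycle bookkeeping AT ψ = 0 only); Movasati–Villaflor Hodge loci of Fermat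
cycles (arXiv:1705.00084; fake linear cycles with non-reduced Hodge loci in degree 6,
arXiv:2112.14818; doi:10.1142/12325 p.127: even-dim mirror family ⇒ invariant-piece Hodge cycles
isolated) — our flat classes are exactly the NON-isolated Fermat Hodge cycles whose Hodge locus
contains the Dwork line; Thomas2005Nodes, Schoen Math.Ann.270 (1985) (cycles from nodes);
BlochSrinivas1983 + Deligne1971 (free engine). DELTA: (i) the flat non-isolated 1170-dim part of
Hdg⁴ along the Dwork SEXTIC pencil as an explicit Hodge/variational-Hodge target with algebraic
Fermat anchor, typed in Lean over real carriers; (ii) Hodge class = character transform of the 1296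
conifold vanishing spheres ⇒ conifold-conjugate-pair prediction and the exact one-surface criterion
Σ_g χ(g)⟨Z, g·Z⟩ ≠ 0; (iii) free sub-engine 'conifold-invariant sublattice ⇒ algebraic' (GIT on the
rational total space + Bloch–Srinivas), shown dead for rank 1 (double cover has h^{5,0} ≠ 0) but
live for rank 2/3; (iv) 'HC for the very general Dwork se  [refs: 10.1142/12325, 1706.01626, 2401.00470, 1705.00084, 2112.14818, doi:10.1142/12325, Katz2009, Kloosterman2017, Aoki1987, Ran1980, BlochSrinivas1983, Deligne1971]

Barriers (technique_class: isotypic-vhs, hypergeometric-monodromy, conifold, vhc-anchor): technique_class: isotypic-vhs, hypergeometric-monodromy, conifold, vhc-anchor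
- Literature.Barriers.HodgeConjecture.Andre1996_hodgeClassesOnAbelianVarieties_motivated: respected
— the 1170 classes are motivated (André transport from Fermat), so a negative search can never
certify ¬HC without contradicting conjecture B; the route is proof-side and 'no surface of degree ≤
D' is exhausted-census evidence only.
- Literature.Barriers.HodgeConjecture.BlochSrinivas1983_hodgeTypeL0_vanish_of_chowZeroSupported:
evaded by scope — decomposition of the diagonal is applied ONLY to the rationally connected total
space 𝒳 ⊂ P⁵×A¹ (birational to P⁵) in the free sub-engine of crux r3, never to the CY fibres
(h^{4,0} = 1); recorded dead for rank-1 pieces (monodromy-trivialising double cover has h^{5,0} ≠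
0).
- Literature.Barriers.HodgeConjecture.Weil1977_exceptionalHodgeClasses,
Literature.Barriers.HodgeConjecture.Mumford1968_simpleFourfold_exceptionalHodgeClasses: the
divisor-ring technique is exactly what fails (H²(X_ψ) = ℚh, the 1170 classes are primitive); never
invoked.
- Literature.Barriers.HodgeConjecture.Voisin2003_generalHypersurface_noIntegralClassInF: no normal
functions / Jacobi inversion / AJ maps of sections — classes are flat along the pencil and detected
by the pencil's own conifold vanishing spheres; ℚ not ℤ coefficients.
- Literature.Barriers.HodgeConjecture.Clemens1983_griffithsGroup_infiniteRank: no
finiteness/representability of cycle groups assumed; conjugate pairs are dif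

Novelty grade: known — ADJUDICATION (refuter route-review 2026-08-15, unit Dw-aa978c70; file REVIEW_Dw_DworkPrymHodge.md on the route). Two earlier grades conflict: 12:24Z `known` (r19: cruxes follow from Chatzistamatiou 2009) vs 12:41Z `new-combination` (Co-9cfa3678: thorough encoding/enumeration review, but its remote s (refuter refuter-rreview-route-HodgeConjecture-Dw-aa978c70-0, 2026-08-15T13:48:05Z; prior: Chatzistamatiou 2009, MRL 16 = arXiv:0804.2472, READ pp.2-8: Thm p.3 = Thm 4 p.7 (every smooth member, n>=2): (X,id) = (X,P) + N'(-1), N' effective (p.4 L13); Prop 1 p.4: N'=(Y,Q), push-forward from an alteration of a divisor; Lemma 3 p.6, Lefschetz (1,1) (tree: Literature.AlgebraicGeometry.HodgeTheory.LefschetzOneOne) + functoriality of cycle classes under correspondences: (2,2)-classes in (1-P)H)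

History (route lifecycle, newest last):
- 2026-08-15T13:48:13Z · CLOSED retired — not-a-thesis: assembly does not conclude the sub-problem Statement (operator:999:1257524)

sub-problem: HodgeConjecture · status: closed(retired) · opened planner-plancard-HodgeConjecture-HodgeConject-7bfd10d8-0 2026-08-15T10:59:42Z · rev 1 · ledger route-HodgeConjecture-DworkPrymHodge
GENERATED by the gate from the ledger (D-0016/17). Provers cite these decls: `theorem foo : Summit.HodgeConjecture.HodgeConjecture.Theses.DworkPrymHodge.<Decl> := …` in Summits/HodgeConjecture/HodgeConjecture/Theorems/<Name>.lean.
-/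

namespace Summit.HodgeConjecture.HodgeConjecture.Theses.DworkPrymHodge

open scoped BigOperators Topology Manifold Classical MeasureTheory ProbabilityTheory Matrix InnerProductSpace ComplexConjugate ContinuousMap
open Filter Set Function TopologicalSpace MeasureTheory

attribute [summit_statement] _root_.HodgeConjecture

/-- item stmt-HodgeConjecture-1926 · target · rank 0 · closed · moot by None · by planner
why it might fail: Open: sextic = first CY degree for fourfold hypersurfaces (cubic Zucker1977, quartic/quintic ConteMurre1978, Fermat sextic Shioda/Aoki); 1170 of the 1171 generic Hodge classes are primitive (H² = ℚh), invisible to divisors. False only if HC fails for a motivated class (¬conj. B).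
sources: Katz2009, Lemma 3.1 and Thm 5.3, Shioda1979HodgeFermat; Aoki1987; Ran1980; arXiv:2401.00470 §§2–3 (HC for the Fermat sextic fourfold, explicit basis), ConteMurre1978; Zucker1977 (= tree Literature.AlgebraicGeometry.Motives.ConteMurreQuarticQuinticStatement, ZuckerCubicFourfoldStatement), Andre1996, Thm 0.5 (motivated ⇒ absolute Hodge on every X_ψ), doi:10.1142/12325 p.127 (Movasati 2021: even-dimensional mirror/Dwork family, invariant-piece Hodge cycles isolated — the complementary piece)
[target] Hodge conjecture for the VERY GENERAL Dwork sextic fourfold: ∃ countable S ⊂ ℂ (containing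
ψ⁶ = 1 and the Hodge-exceptional parameters) such that HodgeConjectureFor 4 X_ψ holds for ψ ∉ S
(Hodge model exists; every rational (p,p)-class lies in algebraicClasses X_ψ p). For such ψ,
Hdg⁴(X_ψ) = ℚh² ⊕ (1170-dim flat part), so the content is exactly cruxes r2 ∧ r3 at generic ψ;
Assembly derives it by bookkeeping. Named sub-family instance of HodgeConjecture, not the summit.
Encoding shared by all items (see thesis): F_ψ := (∑ i, X i^6) − C(6ψ)·∏ X i ∈ ℂ[x₀..x₅]; X_ψ :=
Motives.SmoothHypersurface.hypersurface F_ψ (reduced V₊(F_ψ) ⊂ P⁵, smooth iff ψ⁶ ≠ 1); pt :=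
hypersurfacePoint (hypersurfaceι F_ψ) : X_ψ(ℂ) → ℙ(ℂ⁶) (embedding, in-tree); IsEig b c :⟺ ∀ a ∈ μ₆⁶
with ∏a_i = 1, ∀ continuous g : X_ψ(ℂ) → X_ψ(ℂ) acting as x ↦ a·x on homogeneous coordinates, g^*c =
(∏ a_i^{b_i})·c, i.e. c ∈ V_b(ψ) = χ_b-eigenspace of A = ker(∏)/μ₆ ≅ (ℤ/6)⁴ (g exists, is unique:
DworkSymmetryExists + injectivity of pt; scalars act trivially and χ_b(ζ·1) = ζ^{18} = 1 for flat
b). V_{−b} = conj(V_b); rational classes of V_b ⊕ V_{−b} form its ℚ-structure (ℚ(ζ₆)⁺ = ℚ). -/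
@[route_item "route-HodgeConjecture-DworkPrymHodge"]
def DworkSexticHodge : Prop :=
  ∃ S : Set ℂ, S.Countable ∧ ∀ ψ : ℂ, ψ ∉ S → Literature.AlgebraicGeometry.HodgeTheory.HodgeConjectureFor 4 (Literature.AlgebraicGeometry.Motives.SmoothHypersurface.hypersurface ((∑ i, MvPolynomial.X i ^ 6) - MvPolynomial.C (6 * ψ) * ∏ i, MvPolynomial.X i : MvPolynomial (Fin 6) ℂ))

/-- item stmt-HodgeConjecture-1927 · crux · rank 2 · closed · moot by None · by planner
why it might fail: Literally false only if HC fails for a motivated class (André ⇒ ¬conj. B). Real risk: no surface with χ_b-part ≠ 0 is known on X_ψ, ψ≠0 — base-locus cones are monodromy-invariant (flat part 0), planes die off ψ=0, Zagier's line pencils need odd n; VHC transport from Fermat is open (not semiregular).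
sources: Katz2009, Lemma 3.1 + Thm 5.3 (rank-1 eigensheaf = [6]^*H(1;χ₃): monodromy −1 at ψ⁶=1, trivial at 0, ∞; pp. 8, 13), arXiv:2009.11873 §4.3 (Fermat anchor: (1,2,3,3,4,5) is 3-decomposable ⇒ V_b spanned by plane classes at ψ=0; HC for the Fermat sextic via Ran1980/Shioda1979HodgeFermat/Aoki1987), arXiv:2401.00470 §§2.2–3, 6 (explicit algebraic basis of Hdg⁴ of the Fermat sextic; Hodge loci at Fermat); arXiv:2112.14818 (fake linear cycles: non-reduced Hodge loci in degrees 3,4,6), doi:10.4310/jdg/1404912108 (Zagier 2014, Remark 4: the M_{0,n} line pencils on Σx_iⁿ = nψ∏x_i exist for odd n only — no analogue for the sextic, n = 6); arXiv:1206.4961 (lines on Dwork quintics), Thomas2005Nodes; Schoen1985 (cycles from nodes of degenerations: conifold-pair engine E1), Bloch1972Semiregularity; BuchweitzFlenner2003; Pridham2024 (variational-Hodge transport of the Fermat anchor: engine E-VHC, open in the non-semiregular case)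
[crux] The 360 rank-1 flat lines are algebraic on every smooth member: for ψ⁶ ≠ 1, σ ∈ S₆, b =
(1,2,3,3,4,5)∘σ, every RATIONAL class u + v with u ∈ V_b(ψ), v ∈ V_{−b}(ψ) lies in algebraicClasses
X_ψ 2 (180 rational planes, 360 dims; V_b is pure (2,2) at every ψ by Katz2009 L.3.1, so no
Hodge-type hypothesis appears — a wrong enumeration would make the item refutable). Structure:
monodromy −1 at each ψ⁶ = 1; V_b is spanned by the character transform δ_b = Σ_g χ_b(g)⁻¹ g·δ of the
1296 = |A| conifold vanishing spheres (disjoint, Gram 2·Id); algebraic at ψ = 0 (Fermat). Engines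
(children later): (E1) conifold-conjugate pairs Z± ⊂ X_ψ exchanged by the local monodromy, [Z+] −
[Z−] ∈ ℚ^×·δ_b-part, merging at ψ = 1 into a surface through the nodes / log-lift on Bl_nodes(X_1);
(E-VHC) semiregular A-equivariant lift of a χ_b-weighted Fermat cycle datum along the pencil; (E2)
certificate: by A-stability of algebraicClasses ONE surface Z with Σ_g χ_b(g)⟨Z, g·Z⟩ ≠ 0 proves the
item at that ψ (exact, period-free); (E4) search among surfaces invariant under S ⊂ A⋊S₆ with χ_b|_S
= 1; spread: very general ψ ⇒ all smooth ψ (relative Hilbert scheme + specialisation). -/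
@[route_item "route-HodgeConjecture-DworkPrymHodge"]
def SingletonLinesAlgebraic : Prop :=
  ∀ ψ : ℂ, ψ ^ 6 ≠ 1 → let F : MvPolynomial (Fin 6) ℂ := (∑ i, MvPolynomial.X i ^ 6) - MvPolynomial.C (6 * ψ) * ∏ i, MvPolynomial.X i; let X := Literature.AlgebraicGeometry.Motives.SmoothHypersurface.hypersurface F; let pt := Literature.AlgebraicGeometry.HodgeTheory.hypersurfacePoint (Literature.AlgebraicGeometry.Motives.SmoothHypersurface.hypersurfaceι F); let IsEig : (Fin 6 → ℕ) → Literature.AlgebraicGeometry.HodgeTheory.complexBetti X (2 * 2) → Prop := fun e c => ∀ a : Fin 6 → ℂ, (∀ i, a i ^ 6 = 1) → ∏ i, a i = 1 → ∀ g : C(Literature.AlgebraicGeometry.Motives.ComplexPoints X, Literature.AlgebraicGeometry.Motives.ComplexPoints X), (∀ x, ∃ t : ℂ, (pt (g x)).rep = t • (a * (pt x).rep)) → Literature.AlgebraicTopology.SingularHomology.singularCohomology.map ℂ ℂ g (2 * 2) c = (∏ i, a i ^ e i) • c; ∀ (σ : Equiv.Perm (Fin 6)) (u v : Literature.AlgebraicGeometry.HodgeTheory.complexBetti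 X (2 * 2)), IsEig (fun i => (![1, 2, 3, 3, 4, 5] : Fin 6 → ℕ) (σ i)) u → IsEig (fun i => 6 - (![1, 2, 3, 3, 4, 5] : Fin 6 → ℕ) (σ i)) v → Literature.AlgebraicGeometry.HodgeTheory.IsRationalClass (u + v) → u + v ∈ Literature.AlgebraicGeometry.HodgeTheory.algebraicClasses X 2

/-- item stmt-HodgeConjecture-1928 · crux · rank 3 · closed · moot by None · by planner
why it might fail: Falsity = ¬B as for r2. Failure mode: finite monodromy generated by six conifold pseudo-reflections — no conjugate-pair geometry; the free engine (Deligne invariant cycles + Bloch–Srinivas on the rational total space) reaches only the lattice fixed by all six, whose rank may be 0; rest is open VHC.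
sources: Katz2009, Lemma 3.1(2) + Thm 5.3 (rank-2/3 eigensheaves pure (2,2), = [6]^* of rank-2/3 hypergeometrics; finite monodromy by BeukersHeckman1989 interlacing), Deligne1971, Thm 4.1.1 + BlochSrinivas1983, Thm 1 (= tree Literature.Barriers.HodgeConjecture.BlochSrinivas1983_hodgeConjectureDegreeFour_of_chowZeroSupported): free sub-engine E0 on the rational total space 𝒳 ≃_bir P⁵ only, arXiv:2009.11873 §4.3 (Fermat anchors: (1,1,2,4,5,5)~(1,2,2,4,4,5) and (1,1,3,3,5,5) are 3-decomposable = plane-spanned at ψ=0; (1,2,2,3,5,5)~(1,1,3,4,4,5) is 1-decomposable = needs Aoki–Shioda cycles, Aoki1987), Kloosterman2017 §3 = arXiv:1706.01626 (isotypic pieces of monomial-deformation pencils; cycles via symmetric quotients for K3 pencils), arXiv:2401.00470 §3 (decomposable and Aoki–Shioda Fermat sextic cycles spanning these pieces at ψ = 0)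
[crux] The rank-2 and rank-3 flat pieces are algebraic on every smooth member: for ψ⁶ ≠ 1, σ ∈ S₆, b
= p∘σ with p ∈ {(1,2,2,3,5,5), (1,1,2,4,5,5), (1,1,3,3,5,5)} (the coset-mates (1,1,3,4,4,5),
(1,2,2,4,4,5) give the same characters), every rational class in V_b(ψ) ⊕ V_{−b}(ψ) lies in
algebraicClasses X_ψ 2 (2×360 + 90 = 810 dims; pure (2,2) by Katz2009 L.3.1(2)). Monodromy of V_b
over P¹_ψ ∖ (μ₆ ∪ ∞) is finite, generated by six pseudo-reflections conjugate under (ψ ↦ ζψ, x₀ ↦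
ζ⁻¹x₀). Free sub-engine E0: the sublattice of V_b ⊕ V_{−b} fixed by all six conifold monodromies
consists of global invariant classes over A¹ ∖ μ₆, hence (Deligne1971 4.1.1) of restrictions from H⁴
of a smooth compactification of the total space 𝒳 = {Σx_i⁶ = 6ψ∏x_i} ⊂ P⁵ × A¹, birational to P⁵ (ψ
= Σx_i⁶/6∏x_i), so CH₀ = ℤ and BlochSrinivas1983 makes its degree-4 Hodge classes algebraic — that
sublattice is algebraic unconditionally, its rank a finite computation (A × ⟨g_ζ⟩-module structure
of the six vanishing vectors). The complement needs the reflection-ORBIT analogue of r2's conifold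
pairs or the VHC/semiregular transport from Fermat. Encoding as in the target item / thesis. -/
@[route_item "route-HodgeConjecture-DworkPrymHodge"]
def MultipletonPiecesAlgebraic : Prop :=
  ∀ ψ : ℂ, ψ ^ 6 ≠ 1 → let F : MvPolynomial (Fin 6) ℂ := (∑ i, MvPolynomial.X i ^ 6) - MvPolynomial.C (6 * ψ) * ∏ i, MvPolynomial.X i; let X := Literature.AlgebraicGeometry.Motives.SmoothHypersurface.hypersurface F; let pt := Literature.AlgebraicGeometry.HodgeTheory.hypersurfacePoint (Literature.AlgebraicGeometry.Motives.SmoothHypersurface.hypersurfaceι F); let IsEig : (Fin 6 → ℕ) → Literature.AlgebraicGeometry.HodgeTheory.complexBetti X (2 * 2) → Prop := fun e c => ∀ a : Fin 6 → ℂ, (∀ i, a i ^ 6 = 1) → ∏ i, a i = 1 → ∀ g : C(Literature.AlgebraicGeometry.Motives.ComplexPoints X, Literature.AlgebraicGeometry.Motives.ComplexPoints X), (∀ x, ∃ t : ℂ, (pt (g x)).rep = t • (a * (pt x).rep)) → Literature.AlgebraicTopology.SingularHomology.singularCohomology.map ℂ ℂ g (2 * 2) c = (∏ i, a i ^ e i)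 • c; ∀ (j : Fin 3) (σ : Equiv.Perm (Fin 6)) (u v : Literature.AlgebraicGeometry.HodgeTheory.complexBetti X (2 * 2)), IsEig (fun i => (![![1, 2, 2, 3, 5, 5], ![1, 1, 2, 4, 5, 5], ![1, 1, 3, 3, 5, 5]] : Fin 3 → Fin 6 → ℕ) j (σ i)) u → IsEig (fun i => 6 - (![![1, 2, 2, 3, 5, 5], ![1, 1, 2, 4, 5, 5], ![1, 1, 3, 3, 5, 5]] : Fin 3 → Fin 6 → ℕ) j (σ i)) v → Literature.AlgebraicGeometry.HodgeTheory.IsRationalClass (u + v) → u + v ∈ Literature.AlgebraicGeometry.HodgeTheory.algebraicClasses X 2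

/-- item stmt-HodgeConjecture-1929 · support · rank 9 · closed · moot by None · by planner
sources: Katz2009 Lemma 3.1, Thm 5.3, CattaniDeligneKaplan1995, Deligne1971
[support, theorem-grade] Generic Hodge classes are 'algebraic + flat': ∃ countable S, ∀ ψ ∉ S, every
rational (2,2)-class c ∈ H⁴(X_ψ(ℂ); ℂ) is c = c₀ + Σ_{j<4} Σ_{σ∈S₆} w j σ with c₀ ∈ algebraicClasses
X_ψ 2, each w j σ RATIONAL and in V_{p_j∘σ} ⊕ V_{−p_j∘σ}, p = ((1,2,3,3,4,5), (1,2,2,3,5,5),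
(1,1,2,4,5,5), (1,1,3,3,5,5)). Proof sketch: c = Σ_χ π_χ c over the characters of A (π_χ = |A|⁻¹ Σ_a
χ(a)⁻¹ g_a^*, morphisms of Hodge structures; DworkSymmetryExists + group law from uniqueness);
paired projectors π_χ + π_χ̄ have coefficients in ℚ(ζ₆)⁺ = ℚ, so preserve IsRationalClass and
algebraicClasses. (i) χ = 1: π₁c ∈ ℚh² ⊕ T(ψ), T = [6]^*H_{0,W} of rank 5, Hodge numbers
(1,1,1,1,1), irreducible hypergeometric with a non-(2,2) part ⇒ no rational (2,2)-class for ψ off a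
countable set (Baire + analytic continuation of 's ∈ F²' + deck-group transitivity on Hodge types +
irreducibility: Katz2009 Thm 5.3, Katz ESDE 8.4); h² ∈ algebraicClasses (vanishes off a codim-2
linear section). (ii) χ non-flat, ≠ 1: same argument ⇒ (π_χ + π_χ̄)c = 0 generically. (iii) χ flat:
w := (π_χ + π_χ̄)c. Sources: Katz2009; CattaniDeligneKaplan1995; Deligne1971. -/
@[route_item "route-HodgeConjecture-DworkPrymHodge"]
def GenericHodgeClassesFlat : Prop :=
  ∃ S : Set ℂ, S.Countable ∧ ∀ ψ : ℂ, ψ ∉ S → let F : MvPolynomial (Fin 6) ℂ := (∑ i, MvPolynomial.X i ^ 6) - MvPolynomial.C (6 * ψ) * ∏ i, MvPolynomial.X i; let X := Literature.AlgebraicGeometry.Motives.SmoothHypersurface.hypersurface F; let pt := Literature.AlgebraicGeometry.HodgeTheory.hypersurfacePoint (Literature.AlgebraicGeometry.Motives.SmoothHypersurface.hypersurfaceι F); let IsEig : (Fin 6 → ℕ) → Literature.AlgebraicGeometry.HodgeTheory.complexBetti X (2 * 2) → Prop := fun e c => ∀ a : Fin 6 → ℂ, (∀ i, a i ^ 6 =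 1) → ∏ i, a i = 1 → ∀ g : C(Literature.AlgebraicGeometry.Motives.ComplexPoints X, Literature.AlgebraicGeometry.Motives.ComplexPoints X), (∀ x, ∃ t : ℂ, (pt (g x)).rep = t • (a * (pt x).rep)) → Literature.AlgebraicTopology.SingularHomology.singularCohomology.map ℂ ℂ g (2 * 2) c = (∏ i, a i ^ e i) • c; ∀ c : Literature.AlgebraicGeometry.HodgeTheory.complexBetti X (2 * 2), Literature.AlgebraicGeometry.HodgeTheory.IsRationalClass c → Literature.AlgebraicGeometry.HodgeTheory.IsOfHodgeType 4 X (2 * 2) 2 2 c → ∃ (c₀ : Literature.AlgebraicGeometry.HodgeTheory.complexBetti X (2 * 2)) (w : Fin 4 → Equiv.Perm (Fin 6) → Literature.AlgebraicGeometry.HodgeTheory.complexBetti X (2 * 2)), c₀ ∈ Literature.AlgebraicGeometry.HodgeTheory.algebraicClasses X 2 ∧ (∀ j σ, Literature.AlgebraicGeometry.HodgeTheory.IsRationalClass (w j σ) ∧ ∃ u v : Literature.AlgebraicGeometry.HodgeTheory.complexBetti X (2 * 2), IsEig (fun i => (![![1, 2, 3, 3, 4, 5], ![1, 2, 2, 3,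 5, 5], ![1, 1, 2, 4, 5, 5], ![1, 1, 3, 3, 5, 5]] : Fin 4 → Fin 6 → ℕ) j (σ i)) u ∧ IsEig (fun i => 6 - (![![1, 2, 3, 3, 4, 5], ![1, 2, 2, 3, 5, 5], ![1, 1, 2, 4, 5, 5], ![1, 1, 3, 3, 5, 5]] : Fin 4 → Fin 6 → ℕ) j (σ i)) v ∧ w j σ = u + v) ∧ c = c₀ + ∑ j, ∑ σ, w j σ

/-- item stmt-HodgeConjecture-1930 · support · rank 9 · closed · moot by None · by planner
sources: Literature.AlgebraicGeometry.HodgeTheory.HodgeModelExistence (tree), Literature.AlgebraicGeometry.HodgeTheory.LefschetzOneOne (tree)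
[support, known] For every smooth member (ψ⁶ ≠ 1): a Hodge model of X_ψ exists (GAGA + Hodge
decomposition; tree HodgeModelExistence) and the Hodge conjecture holds on X_ψ in every codimension
p ≠ 2: p = 0 trivial (algebraicClasses_zero), p = 1 Lefschetz (1,1) (H² = ℚh by weak Lefschetz
anyway), p = 3: H⁶(X_ψ, ℚ) = ℚh³ (weak Lefschetz + Poincaré duality), h³ supported on a codim-3
linear section, p = 4: point class, p ≥ 5: H^{2p} = 0 (real dimension 8). Smoothness: ∂_iF_ψ = 6x_i⁵
− 6ψ∏_{j≠i}x_j, so F_ψ is nonsingular iff ψ⁶ ≠ 1. Filed so that the Assembly is pure bookkeeping.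
Encoding as in the target item. -/
@[route_item "route-HodgeConjecture-DworkPrymHodge", crux]
def DworkOtherCodimensions : Prop :=
  ∀ ψ : ℂ, ψ ^ 6 ≠ 1 → let F : MvPolynomial (Fin 6) ℂ := (∑ i, MvPolynomial.X i ^ 6) - MvPolynomial.C (6 * ψ) * ∏ i, MvPolynomial.X i; let X := Literature.AlgebraicGeometry.Motives.SmoothHypersurface.hypersurface F; Nonempty (Literature.AlgebraicGeometry.HodgeTheory.HodgeModel 4 X) ∧ ∀ p : ℕ, p ≠ 2 → ∀ c : Literature.AlgebraicGeometry.HodgeTheory.complexBetti X (2 * p), Literature.AlgebraicGeometry.HodgeTheory.IsRationalClass c → Literature.AlgebraicGeometry.HodgeTheory.IsOfHodgeType 4 X (2 * p) p p c → c ∈ Literature.AlgebraicGeometry.HodgeTheory.algebraicClasses X p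

/-- item stmt-HodgeConjecture-1931 · support · rank 9 · closed · moot by None · by planner
sources: Literature.AlgebraicGeometry.HodgeTheory.isEmbedding_hypersurfacePoint, range_hypersurfacePoint (tree), Katz2009 §2 (Γ_W/Δ acts on the family)
[support, CONSTRUCTION statement for the posited interface] For every ψ and every a ∈ ℂ⁶ with a_i⁶ =
1, ∏ a_i = 1 there is a continuous self-map g of X_ψ(ℂ) acting as x ↦ a·x on homogeneous coordinates
(∃ t, rep(pt(g x)) = t·(a * rep(pt x))). True: F_ψ(a·x) = Σ a_i⁶x_i⁶ − 6ψ ∏a_i ∏x_i = F_ψ(x); pt is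
an embedding onto {[z] : F_ψ(z) = 0} (tree: isEmbedding_hypersurfacePoint, range_hypersurfacePoint)
and z ↦ a·z is a homeomorphism of ℙ(ℂ⁶) preserving it; g is the analytification of the scheme
automorphism (liftOfRangeSubset of hypersurfaceι ≫ substMap(diag a)). Uniqueness for given a follows
from injectivity of pt. Not in the Assembly chain (the cruxes quantify over all such g); it
certifies that IsEig cuts out the genuine χ_b-eigenspace rather than a vacuous condition. -/
@[route_item "route-HodgeConjecture-DworkPrymHodge"]
def DworkSymmetryExists : Prop :=
  ∀ ψ : ℂ, let F : MvPolynomial (Fin 6) ℂ := (∑ i, MvPolynomial.X i ^ 6) - MvPolynomial.C (6 * ψ) * ∏ i, MvPolynomial.X i; let X := Literature.AlgebraicGeometry.Motives.SmoothHypersurface.hypersurface F; let pt := Literature.AlgebraicGeometry.HodgeTheory.hypersurfacePoint (Literature.AlgebraicGeometry.Motives.SmoothHypersurface.hypersurfaceι F); ∀ a : Fin 6 → ℂ, (∀ i, a i ^ 6 = 1) → ∏ i, a i = 1 → ∃ g : C(Literature.AlgebraicGeometry.Motives.ComplexPoints X, Literature.AlgebraicGeometry.Motives.ComplexPoints X),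 ∀ x, ∃ t : ℂ, (pt (g x)).rep = t • (a * (pt x).rep)

/-- item stmt-HodgeConjecture-1932 · assembly · rank 1 · closed · moot by None · by planner
[assembly] SingletonLinesAlgebraic → MultipletonPiecesAlgebraic → GenericHodgeClassesFlat →
DworkOtherCodimensions → DworkSexticHodge. Bookkeeping, provable now: S' := S ∪ {ψ | ψ⁶ = 1} (S from
GenericHodgeClassesFlat; the root set is finite) is countable. For ψ ∉ S': HodgeConjectureFor 4 X_ψ
= ⟨Hodge model from DworkOtherCodimensions, fun p c hrat hhodge => …⟩; p ≠ 2: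
DworkOtherCodimensions; p = 2 (types agree: complexBetti X (2*2), IsOfHodgeType 4 X (2*2) 2 2; all
`let`s zeta-reduce to identical terms): decompose c = c₀ + Σ_j Σ_σ w j σ by GenericHodgeClassesFlat;
j = 0: row (1,2,3,3,4,5), SingletonLinesAlgebraic ψ hψ σ u v; j = 1,2,3: the rows of the Fin 4
matrix are those of the Fin 3 matrix of MultipletonPiecesAlgebraic (fin_cases j;
Matrix.cons_val_succ); finish with Submodule.add_mem / Submodule.sum_mem. -/
@[route_item "route-HodgeConjecture-DworkPrymHodge"]
def Assembly : Prop :=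
  SingletonLinesAlgebraic → MultipletonPiecesAlgebraic → GenericHodgeClassesFlat → DworkOtherCodimensions → DworkSexticHodge

end Summit.HodgeConjecture.HodgeConjecture.Theses.DworkPrymHodge
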